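import Summits.CriticalPhenomena.PercolationContinuityZ3.Theorems.PercNearOneGluingNoHeavyLowerTailCubicThreePointBernsteinStep
import Mathlib.Tactic.Linarith
import Mathlib.Tactic.LinearCombination
import Mathlib.Tactic.Ring
import Mathlib.Tactic.Positivity
import HarnessLib

/-!
# `NoHeavyLowerTail` (stmt-CriticalPhenomena-4575) — the two TIGHT families of the cubic three-point rows (triangle and star laws), as identities

Support file (prover prim-ineq-gen-2 gen 2, new-inequality factory; `--supports stmt-CriticalPhenomena-4575`).  Pure algebra over a commutative
ring / `ℝ`; no measure theory, no definitions, no named facts, no sorries.  Cell convention of `CubicThreePointStep`: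
`(q,u₁,u₂,u₃,t) = (P(a|b|c), P(ab|c), P(ac|b), P(bc|a), P(abc))`, `AG := qt − e₂(u)` (Gladkov's quadratic row, tree
`prodBernoulli_threePoint_strongHarris`), and the factory's cubic candidates (INEQ-CLAIMS rows 24, 57–60; memos prim-lit-2 §16.6, prim-ineq-gen-5 g3,
prim-ineq-gen-2/EDGE-STEP.md):  `AG⁺ := σ·AG − e₃` ('G3'),  `Hb := q·AG − e₃`,  `Ha := t·AG − e₃`,  SF3-Hmax `:= max(q,t)·AG − e₃`, HQT3 `:= (q+t)AG − e₃`.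

WHAT IS RECORDED.  The three-point law of the TRIANGLE with independent edges `ab = x, ac = y, bc = z` is
`q = (1−x)(1−y)(1−z)`, `u₁ = x(1−y)(1−z)`, `u₂ = y(1−x)(1−z)`, `u₃ = z(1−x)(1−y)`, `t = xy+xz+yz−2xyz`; the law of the STEINER STAR (hub `s`,
edges `as = x, bs = y, cs = z`) is `u₁ = xy(1−z)`, `u₂ = xz(1−y)`, `u₃ = yz(1−x)`, `t = xyz`, `q = 1 − xy − xz − yz + 2xyz`.  On these:
* `hb_triangle` : `Hb = 0` identically (the triangle sheet of SF3-Hmax; every 'ring of two-terminal blobs' has a triangle law);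
* `ha_star` : `Ha = 0` identically (the star sheet; every 'star of blobs');
* `agPlus_triangle` : `AG⁺ = (1−q)·x(1−x)y(1−y)z(1−z)` — so `AG⁺/(1−q) = ∏_e w_e(1−w_e)` on triangles (the normalisation under which the factory's
  'exists-a-good-edge' step has no known failure, EDGE-STEP.md §6a);  `agPlus_star` : `AG⁺ = (1−t)·x(1−x)y(1−y)z(1−z)` (dual);
* `hb_star` : `Hb = x y z (1−x)(1−y)(1−z)·(q − t)` — the star violates `Hb ≥ 0` exactly when `t > q`, which is why SF3-Hmax carries `max(q,t)`;
  `ha_triangle` : `Ha = x y z(1−x)(1−y)(1−z)·(t − q)` (dual);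
* `ha_eq_sq_sub_prod`, `hb_eq_sq_sub_prod` : for a law (`σ = 1`), `Ha = t² − (t+u₁)(t+u₂)(t+u₃) = P(abc)² − P(ab)P(ac)P(bc)` and
  `Hb = q² − (q+u₁)(q+u₂)(q+u₃) = P(a|b|c)² − ∏_v P(v isolated from the other two)` — SF3-Hmax reads: `P(abc) ≥ P(a|b|c) ⇒ P(abc)² ≥ P(ab)P(ac)P(bc)`
  (a reverse companion of Gladkov's `P(abc)² ≤ 8 P(ab)P(ac)P(bc)`), and dually;
* `shk3_of_agPlus`, `agPlus_of_hqt`, `hqt_of_hb`, `hqt_of_ha` : the pointwise chain  Hmax ⇒ HQT3 ⇒ AG⁺ ⇒ SHK3⁺ (`CubicThreePointStep.F ≥ 0`) for nonnegative cells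
  with `AG ≥ 0` — a proof of the weakest cubic row AG⁺ already settles SHK3⁺ (Richards–Sahi `E₃ ≥ 0` on the pairwise separations) outright.
Equality loci observed in the censuses (ttrl2 `sf3`, lit-2 §16.6, kit j061979/j061980 of this seat): Hmax = 0 exactly on these two sheets and on the cut-vertex boundary.
[cite: Gladkov2024StrongFKG, Cor. 4.2 (AG)]; [cite: Gladkov2024, Thm. 1.1 (the `√8` upper bound)]
-/

namespace Summit.CriticalPhenomena.PercolationContinuityZ3.Theorems

namespace CubicThreePointStep

section Ring

variable {R : Type*} [CommRing R]

/-- **Triangle sheet: `Hb = q·(qt − e₂) − e₃ = 0`** on the triangle law with edge weights `x = w(ab), y = w(ac), z = w(bc)`. [folklore] -/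
theorem hb_triangle (x y z : R) :
    ((1 - x) * (1 - y) * (1 - z)) *
          (((1 - x) * (1 - y) * (1 - z)) * (x * y + x * z + y * z - 2 * x * y * z) -
            ((x * (1 - y) * (1 - z)) * (y * (1 - x) * (1 - z)) + (x * (1 - y) * (1 - z)) * (z * (1 - x) * (1 - y)) +
              (y * (1 - x) * (1 - z)) * (z * (1 - x) * (1 - y)))) -
        (x * (1 - y) * (1 - z)) * (y * (1 - x) * (1 - z)) * (z * (1 - x) * (1 - y)) = 0 := by
  ring

/-- **Triangle: `AG⁺ = (1 − q)·∏ w_e(1 − w_e)`**, i.e. `σ·(qt − e₂) − e₃ = (1−q)·x(1−x)y(1−y)z(1−z)` with `σ = 1` written as `q + u₁ + u₂ + u₃ + t`. [folklore] -/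
theorem agPlus_triangle (x y z : R) :
    ((1 - x) * (1 - y) * (1 - z) + x * (1 - y) * (1 - z) + y * (1 - x) * (1 - z) + z * (1 - x) * (1 - y) +
            (x * y + x * z + y * z - 2 * x * y * z)) *
          (((1 - x) * (1 - y) * (1 - z)) * (x * y + x * z + y * z - 2 * x * y * z) -
            ((x * (1 - y) * (1 - z)) * (y * (1 - x) * (1 - z)) + (x * (1 - y) * (1 - z)) * (z * (1 - x) * (1 - y)) +
              (y * (1 - x) * (1 - z)) * (z * (1 - x) * (1 - y)))) -
        (x * (1 - y) * (1 - z)) * (y * (1 - x) * (1 - z)) * (z * (1 - x) * (1 - y)) =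
      (1 - (1 - x) * (1 - y) * (1 - z)) * (x * (1 - x) * (y * (1 - y)) * (z * (1 - z))) := by
  ring

/-- **Triangle: `Ha = t·(qt − e₂) − e₃ = x y z(1−x)(1−y)(1−z)·(t − q)`** — negative exactly when `q > t` (sparse triangles), the reason
SF3-Hmax uses `max(q,t)`. [folklore] -/
theorem ha_triangle (x y z : R) :
    (x * y + x * z + y * z - 2 * x * y * z) *
          (((1 - x) * (1 - y) * (1 - z)) * (x * y + x * z + y * z - 2 * x * y * z) -
            ((x * (1 - y) * (1 - z)) * (y * (1 - x) * (1 - z)) + (x * (1 - y) * (1 - z)) * (z * (1 - x) * (1 - y)) +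
              (y * (1 - x) * (1 - z)) * (z * (1 - x) * (1 - y)))) -
        (x * (1 - y) * (1 - z)) * (y * (1 - x) * (1 - z)) * (z * (1 - x) * (1 - y)) =
      x * y * z * ((1 - x) * (1 - y) * (1 - z)) *
        ((x * y + x * z + y * z - 2 * x * y * z) - (1 - x) * (1 - y) * (1 - z)) := by
  ring

/-- **Star sheet: `Ha = t·(qt − e₂) − e₃ = 0`** on the Steiner-star law with arm weights `x = w(as), y = w(bs), z = w(cs)`. [folklore] -/
theorem ha_star (x y z : R) :
    (x * y * z) *
          ((1 - x * y - x * z - y * z + 2 * x * y * z) * (x * y * z) -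
            ((x * y * (1 - z)) * (x * z * (1 - y)) + (x * y * (1 - z)) * (y * z * (1 - x)) + (x * z * (1 - y)) * (y * z * (1 - x)))) -
        (x * y * (1 - z)) * (x * z * (1 - y)) * (y * z * (1 - x)) = 0 := by
  ring

/-- **Star: `AG⁺ = (1 − t)·∏ w_e(1 − w_e)`** (`σ` written out as the sum of the five cells). [folklore] -/
theorem agPlus_star (x y z : R) :
    ((1 - x * y - x * z - y * z + 2 * x * y * z) + x * y * (1 - z) + x * z * (1 - y) + y * z * (1 - x) + x * y * z) *
          ((1 - x * y - x * z - y * z + 2 * x * y * z) * (x * y * z) -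
            ((x * y * (1 - z)) * (x * z * (1 - y)) + (x * y * (1 - z)) * (y * z * (1 - x)) + (x * z * (1 - y)) * (y * z * (1 - x)))) -
        (x * y * (1 - z)) * (x * z * (1 - y)) * (y * z * (1 - x)) =
      (1 - x * y * z) * (x * (1 - x) * (y * (1 - y)) * (z * (1 - z))) := by
  ring

/-- **Star: `Hb = q·(qt − e₂) − e₃ = x y z(1−x)(1−y)(1−z)·(q − t)`** — negative exactly when `t > q` (dense stars). [folklore] -/
theorem hb_star (x y z : R) :
    (1 - x * y - x * z - y * z + 2 * x * y * z) *
          ((1 - x * y - x * z - y * z + 2 * x * y * z) * (x * y * z) -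
            ((x * y * (1 - z)) * (x * z * (1 - y)) + (x * y * (1 - z)) * (y * z * (1 - x)) + (x * z * (1 - y)) * (y * z * (1 - x)))) -
        (x * y * (1 - z)) * (x * z * (1 - y)) * (y * z * (1 - x)) =
      x * y * z * ((1 - x) * (1 - y) * (1 - z)) * ((1 - x * y - x * z - y * z + 2 * x * y * z) - x * y * z) := by
  ring

/-- **`Ha = P(abc)² − P(ab)P(ac)P(bc)`**: for cells of total mass one, `t(qt − e₂) − e₃ = t² − (t+u₁)(t+u₂)(t+u₃)`. [folklore] -/
theorem ha_eq_sq_sub_prod (q u₁ u₂ u₃ t : R) (hσ : q + u₁ + u₂ + u₃ + t = 1) :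
    t * (q * t - (u₁ * u₂ + u₁ * u₃ + u₂ * u₃)) - u₁ * u₂ * u₃ = t ^ 2 - (t + u₁) * (t + u₂) * (t + u₃) := by
  linear_combination (t ^ 2) * hσ

/-- **`Hb = P(a|b|c)² − ∏_v P(v isolated from the other two)`**: for total mass one, `q(qt − e₂) − e₃ = q² − (q+u₁)(q+u₂)(q+u₃)`
(`q + u₁ = P(c ≁ a, c ≁ b)` etc.). [folklore] -/
theorem hb_eq_sq_sub_prod (q u₁ u₂ u₃ t : R) (hσ : q + u₁ + u₂ + u₃ + t = 1) :
    q * (q * t - (u₁ * u₂ + u₁ * u₃ + u₂ * u₃)) - u₁ * u₂ * u₃ = q ^ 2 - (q + u₁) * (q + u₂) * (q + u₃) := by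
  linear_combination (q ^ 2) * hσ

end Ring

/-! ### The pointwise chain Hmax ⇒ HQT3 ⇒ AG⁺ ⇒ SHK3⁺ -/

/-- **AG⁺ ⇒ SHK3⁺.**  For `t ≥ 0` and Gladkov's `AG = qt − e₂ ≥ 0`: if `qt − e₂ − e₃ ≥ 0` then `F = (σ+t)(qt−e₂) − e₃ ≥ 0` (total mass one). [folklore] -/
theorem shk3_of_agPlus {q u₁ u₂ u₃ t : ℝ} (hσ : q + u₁ + u₂ + u₃ + t = 1) (ht : 0 ≤ t)
    (hAG : 0 ≤ q * t - (u₁ * u₂ + u₁ * u₃ + u₂ * u₃))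
    (h : 0 ≤ q * t - (u₁ * u₂ + u₁ * u₃ + u₂ * u₃) - u₁ * u₂ * u₃) :
    0 ≤ F q u₁ u₂ u₃ t := by
  have hmul : 0 ≤ t * (q * t - (u₁ * u₂ + u₁ * u₃ + u₂ * u₃)) := mul_nonneg ht hAG
  have hF : F q u₁ u₂ u₃ t = (q * t - (u₁ * u₂ + u₁ * u₃ + u₂ * u₃) - u₁ * u₂ * u₃) +
      t * (q * t - (u₁ * u₂ + u₁ * u₃ + u₂ * u₃)) := by
    simp only [F]
    linear_combination (q * t - (u₁ * u₂ + u₁ * u₃ + u₂ * u₃)) * hσ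
  rw [hF]
  linarith

/-- **HQT3 ⇒ AG⁺.**  With `q + t ≤ 1` (nonnegative cells, total mass one) and `AG ≥ 0`: `(q+t)·AG − e₃ ≥ 0 ⇒ AG − e₃ ≥ 0`. [folklore] -/
theorem agPlus_of_hqt {q u₁ u₂ u₃ t : ℝ} (hσ : q + u₁ + u₂ + u₃ + t = 1) (h₁ : 0 ≤ u₁) (h₂ : 0 ≤ u₂) (h₃ : 0 ≤ u₃)
    (hAG : 0 ≤ q * t - (u₁ * u₂ + u₁ * u₃ + u₂ * u₃))
    (h : 0 ≤ (q + t) * (q * t - (u₁ * u₂ + u₁ * u₃ + u₂ * u₃)) - u₁ * u₂ * u₃) :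
    0 ≤ q * t - (u₁ * u₂ + u₁ * u₃ + u₂ * u₃) - u₁ * u₂ * u₃ := by
  have hqt : q + t ≤ 1 := by linarith
  nlinarith

/-- **Hb ⇒ HQT3** (the `q ≥ t` sheet of SF3-Hmax): with `t ≥ 0`, `AG ≥ 0`, `q·AG − e₃ ≥ 0 ⇒ (q+t)·AG − e₃ ≥ 0`. [folklore] -/
theorem hqt_of_hb {q u₁ u₂ u₃ t : ℝ} (ht : 0 ≤ t) (hAG : 0 ≤ q * t - (u₁ * u₂ + u₁ * u₃ + u₂ * u₃))
    (h : 0 ≤ q * (q * t - (u₁ * u₂ + u₁ * u₃ + u₂ * u₃)) - u₁ * u₂ * u₃) :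
    0 ≤ (q + t) * (q * t - (u₁ * u₂ + u₁ * u₃ + u₂ * u₃)) - u₁ * u₂ * u₃ := by
  nlinarith [mul_nonneg ht hAG]

/-- **Ha ⇒ HQT3** (the `t ≥ q` sheet of SF3-Hmax): with `q ≥ 0`, `AG ≥ 0`, `t·AG − e₃ ≥ 0 ⇒ (q+t)·AG − e₃ ≥ 0`. [folklore] -/
theorem hqt_of_ha {q u₁ u₂ u₃ t : ℝ} (hq : 0 ≤ q) (hAG : 0 ≤ q * t - (u₁ * u₂ + u₁ * u₃ + u₂ * u₃))
    (h : 0 ≤ t * (q * t - (u₁ * u₂ + u₁ * u₃ + u₂ * u₃)) - u₁ * u₂ * u₃) :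
    0 ≤ (q + t) * (q * t - (u₁ * u₂ + u₁ * u₃ + u₂ * u₃)) - u₁ * u₂ * u₃ := by
  nlinarith [mul_nonneg hq hAG]

end CubicThreePointStep

end Summit.CriticalPhenomena.PercolationContinuityZ3.Theorems
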